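import Summits.ResolutionOfSingularities.ResolutionOfSingularities.Theorems.PurelyInseparableDim4ResConePowerCone
import Summits.ResolutionOfSingularities.ResolutionOfSingularities.Theorems.PurelyInseparableDim4ResConeFormPersist
import Summits.ResolutionOfSingularities.ResolutionOfSingularities.Theorems.PurelyInseparableDim4ResConeSatChain
import HarnessLib
import HarnessLib.Audit.Tags

/-!
# Purely inseparable four-folds — the TAME CONE ALONG A CHAIN, SLICE B: the POWER-CONE PACKAGE along a
# constant-`(d, e_G = 3)` stretch (`g_k = a_k · ℓ_k^d`, `ℓ_k(direction_k) = 0`, `ℓ_{k+1}|_{i ≠ j_k} = λ_k · ℓ_k|`)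

[OURS · counted 0 · cell `res-dim4-pi` · K2(p) lane (holder res-dim4-p-12 lineage, interim res-dim4-p-7 g2; desk WORDS
#78 (a) / #79 (b): res-dim4-p-12 g2's HANDOFF-g2 «next bricks» item 3 «e = 3 CHAIN PACKAGING») · seat res-dim4-p-2 g3 ·
K lane crit-4 g2 (K-A4).]  Nothing here proves K2(p) = `RidgeBudget.NoAboveFloorTrap p p`, `NoIsolatedTrap p p` or
resolution of singularities in dimension ≥ 4 / characteristic `p`.

The step-lemmas of the slice-B letter files are stated for ONE band step with explicit band data:
`…ResConePowerCone.resForm_eq_C_mul_pow_of_finrank_eq_three` (res-dim4-p-12 g2: in the tame range `d < p` a state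
with `e_G = finrank (resVertex s) = 3` has residual cone `g = C a * ℓ^d` with `resVertex s = ker ℓ`, `ℓ ≠ 0`),
`…ResConeNear.direction_mem_resVertex_of_shade_eq` ((VT)(i): the direction of a shade-keeping step lies in the polar
kernel) and `…ResConeFormPersist.linearForm_step_proportional_off_chart` (res-dim4-p-5 g2, T-PERSIST: across a
shade-keeping step whose two vertices are hyperplanes `ker ℓ`, `ker ℓ′`, `ℓ′ = λ·ℓ` OFF the chart letter, `λ ≠ 0`).
Consumers of the K2(p) ledger (slice B of `…ResConeTameSlices.noAboveFloorTrap_iff_tameSlices`, p673897; idea-4's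
I-4-7 game) work with CHAINS: an isolated above-floor `Step0 p` chain `c` with `x^{r₀} ∣ F₀`, witnessed by charts and
chart points `(j k, b k)` (`FreeTail.IsWitnessedChain p c j b`), of constant natural shade `d < p` and constant
`finrank (resVertex (c k)) = 3` from an index `k₀` on.  This file does the band bookkeeping once (as p-5's
`…ResConeSatChain` did for slice C) and packages, for every `k ≥ k₀`:

* `chain_shade_nat` — `ord₀ (c k) = o`, `p < o < 2p`, `o − |r_k| = d`;
* **`chain_resForm_eq_C_mul_pow`** — `∃ ℓ ≠ 0, a`: `resVertex (c k) = ker ℓ` and `resForm (c k) = C a * (Σ C ℓᵢ Xᵢ)^d`;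
* **`chain_linearForm_direction`** — for any `ℓ` cutting out `resVertex (c k)`: `ℓ ⬝ᵥ direction (j k) (b k) = 0`,
  i.e. `ℓ (j k) = −(ℓ ⬝ᵥ b k)` (the chart coefficient is READ OFF the chart point);
* **`chain_linearForm_proportional`** — for `ℓ`, `ℓ′` cutting out `resVertex (c k)`, `resVertex (c (k+1))`, `ℓ ≠ 0`:
  `∃ λ ≠ 0, ∀ i ≠ j k, ℓ′ i = λ * ℓ i` (T-PERSIST along the chain), and a letter `i ≠ j k` carrying `ℓ` keeps
  carrying `ℓ′`;
* **`chain_powerCone_package`** — ONE choice of `ℓ : ℕ → (Fin 4 → K)`, `a λ : ℕ → K` with all of the above for every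
  `k ≥ k₀` (the I-4-7 game input: «one frame serves the whole stretch», the form changes only by a unit and by its
  chart coefficient, which the chart point dictates).

[cite: CossartJannsenSaito2020, Thm. 3.10(4), Thm. 3.14]
bears_on: LADDER-RESOLUTION:D157-DOOR2 (res-dim4-pi · K2(p) = `RidgeBudget.NoAboveFloorTrap p p`, slice B).
Supports stmt-ResolutionOfSingularities-16155 (helper).
-/

set_option linter.dupNamespace false -- mandated namespace of this single-conjunct summit

noncomputable section

namespace Summit.ResolutionOfSingularities.ResolutionOfSingularities.Theorems.PIDim4

namespace ResCone

open MvPolynomial Finset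
open Literature.AlgebraicGeometry.Resolution
open Literature.AlgebraicGeometry.Resolution.CentreBlowup
open Literature.AlgebraicGeometry.Resolution.Hauser2010
open Literature.AlgebraicGeometry.Resolution.HauserPerlega2019
open PointBlowup (polarMap additiveSubspace direction)

variable {K : Type} [Field K]

section PowerChain

variable (p : ℕ) [Fact p.Prime] [CharP K p] [DecidableEq K]

omit [CharP K p] in
/-- **Band data in natural form on the constant-shade tail**: `ord₀ (c k) = o` with `p < o < 2p` and
`o − |r_k| = d`. [OURS] -/
theorem chain_shade_nat {c : ℕ → State K} (hc : ∀ k, IsIsolated p (c k).F ∧ Step0 p (c k) (c (k + 1)))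
    (hfloor : ∀ k, ordZero (c k).F ≠ p) {k₀ d : ℕ} (hshade : ∀ k, k₀ ≤ k → (c k).shade = (d : ℕ∞)) {k : ℕ}
    (hk : k₀ ≤ k) : ∃ o : ℕ, ordZero (c k).F = o ∧ p < o ∧ o < 2 * p ∧ o - (c k).r.degree = d := by
  obtain ⟨o, ho, hpo, ho2⟩ := chain_band p hc hfloor k
  refine ⟨o, ho, hpo, ho2, ?_⟩
  have h := hshade k hk
  rw [BandShade.shade_eq_coe ho] at h
  exact_mod_cast h

/-- **THE POWER CONE along the chain** (slice B, `d < p`): at every stage `k ≥ k₀` the residual cone is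
`C a * ℓ^d` for a non-zero linear form `ℓ` whose kernel is the polar kernel `resVertex (c k)`.
[OURS] [cite: CossartJannsenSaito2020, Thm. 3.14] -/
theorem chain_resForm_eq_C_mul_pow {c : ℕ → State K}
    (hc : ∀ k, IsIsolated p (c k).F ∧ Step0 p (c k) (c (k + 1))) (hfloor : ∀ k, ordZero (c k).F ≠ p)
    {k₀ d : ℕ} (hdp : d < p) (hshade : ∀ k, k₀ ≤ k → (c k).shade = (d : ℕ∞))
    (he3 : ∀ k, k₀ ≤ k → Module.finrank K (resVertex (c k)) = 3) {k : ℕ} (hk : k₀ ≤ k) :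
    ∃ (ℓ : Fin 4 → K) (a : K), ℓ ≠ 0 ∧ (∀ w, w ∈ resVertex (c k) ↔ dotProduct ℓ w = 0) ∧
      resForm (c k) = C a * (∑ i, C (ℓ i) * X i) ^ d := by
  obtain ⟨o, ho, -, -, hod⟩ := chain_shade_nat p hc hfloor hshade hk
  obtain ⟨ℓ, a, hℓ, hV, hform⟩ :=
    resForm_eq_C_mul_pow_of_finrank_eq_three p ho (by rw [hod]; exact hdp) (he3 k hk)
  refine ⟨ℓ, a, hℓ, fun w => ?_, by rw [hform, hod]⟩
  rw [hV w]
  rfl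

omit [CharP K p] in
/-- **The vertex form kills the direction of the step** (slice B form of (VT)(i)): for any `ℓ` cutting out
`resVertex (c k)` on the constant-shade tail, `ℓ ⬝ᵥ direction (j k) (b k) = 0`; equivalently the CHART COEFFICIENT of
`ℓ` is read off the chart point: `ℓ (j k) + ℓ ⬝ᵥ (b k) = 0`. [OURS] [cite: CossartJannsenSaito2020, Thm. 3.14] -/
theorem chain_linearForm_direction {c : ℕ → State K} {j : ℕ → Fin 4} {b : ℕ → Fin 4 → K}
    (hc : ∀ k, IsIsolated p (c k).F ∧ Step0 p (c k) (c (k + 1))) (hw : FreeTail.IsWitnessedChain p c j b)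
    (hr0 : ∀ e ∈ (c 0).F.support, (c 0).r ≤ e) (hfloor : ∀ k, ordZero (c k).F ≠ p) {k₀ d : ℕ}
    (hshade : ∀ k, k₀ ≤ k → (c k).shade = (d : ℕ∞)) {k : ℕ} (hk : k₀ ≤ k) {ℓ : Fin 4 → K}
    (hV : ∀ w, w ∈ resVertex (c k) ↔ dotProduct ℓ w = 0) :
    dotProduct ℓ (direction (j k) (b k)) = 0 ∧ ℓ (j k) + dotProduct ℓ (b k) = 0 := by
  have hmem := chain_direction_mem_resVertex p hc hw hr0 hfloor hshade hk
  have h0 : dotProduct ℓ (direction (j k) (b k)) = 0 := (hV _).mp hmem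
  refine ⟨h0, ?_⟩
  rwa [dotProduct_direction ℓ (j k) (b k) (hw k).2.1] at h0

omit [CharP K p] in
/-- **T-PERSIST along the chain**: for `ℓ`, `ℓ′` cutting out the vertices at stages `k`, `k + 1` of the
constant-shade tail (`ℓ ≠ 0`), `ℓ′ = λ · ℓ` OFF the chart letter `j k` for a unit `λ`; and a letter `i ≠ j k`
carrying `ℓ` keeps carrying `ℓ′`. [OURS] [cite: CossartJannsenSaito2020, Thm. 3.14] -/
theorem chain_linearForm_proportional {c : ℕ → State K} {j : ℕ → Fin 4} {b : ℕ → Fin 4 → K}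
    (hc : ∀ k, IsIsolated p (c k).F ∧ Step0 p (c k) (c (k + 1))) (hw : FreeTail.IsWitnessedChain p c j b)
    (hr0 : ∀ e ∈ (c 0).F.support, (c 0).r ≤ e) (hfloor : ∀ k, ordZero (c k).F ≠ p) {k₀ d : ℕ}
    (hshade : ∀ k, k₀ ≤ k → (c k).shade = (d : ℕ∞)) {k : ℕ} (hk : k₀ ≤ k) {ℓ ℓ' : Fin 4 → K}
    (hV : ∀ w, w ∈ resVertex (c k) ↔ dotProduct ℓ w = 0)
    (hV' : ∀ w, w ∈ resVertex (c (k + 1)) ↔ dotProduct ℓ' w = 0) (hℓ : ℓ ≠ 0) :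
    (∃ lam : K, lam ≠ 0 ∧ ∀ i, i ≠ j k → ℓ' i = lam * ℓ i) ∧
      (∃ i, i ≠ j k ∧ ℓ i ≠ 0) ∧ ∀ i, i ≠ j k → ℓ i ≠ 0 → ℓ' i ≠ 0 := by
  obtain ⟨o, ho, hpo, ho2, -⟩ := chain_shade_nat p hc hfloor hshade hk
  have hr := IsolatedBand.isolated_chain_forall_le hc hr0 k
  have hck := (hw k).2.2.2.2
  have heq := chain_shade_step p hw hshade hk
  have hV'' : ∀ w, w ∈ resVertex (CentreBlowup.step p Finset.univ (j k) (b k) (c k)) ↔ dotProduct ℓ' w = 0 := by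
    rw [← hck]; exact hV'
  exact ⟨linearForm_step_proportional_off_chart (j k) (hw k).2.1 ho hr hpo ho2 heq hV hV'' hℓ,
    exists_apply_ne_zero_off_chart (j k) (hw k).2.1 ho hr hpo ho2 heq hV hℓ,
    fun i hij hi => apply_ne_zero_step_of_apply_ne_zero (j k) (hw k).2.1 ho hr hpo ho2 heq hV hV'' hℓ hij hi⟩

/-- **THE POWER-CONE PACKAGE along a constant-`(d, e_G = 3)` stretch** (slice B; the I-4-7 game input): ONE choice
of vertex forms `ℓ k`, cone coefficients `a k` and units `λ k` such that for every `k ≥ k₀`: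
`ℓ k ≠ 0`, `resVertex (c k) = ker (ℓ k)`, `resForm (c k) = C (a k) * (Σ C (ℓ k i) Xᵢ)^d`,
`ℓ k (j k) + ℓ k ⬝ᵥ b k = 0` (the chart coefficient is dictated by the chart point), `λ k ≠ 0` and
`ℓ (k+1) i = λ k * ℓ k i` for all `i ≠ j k` (the form persists off the chart letter), and some letter `i ≠ j k`
carries `ℓ k`. [OURS] [cite: CossartJannsenSaito2020, Thm. 3.10(4), Thm. 3.14] -/
theorem chain_powerCone_package {c : ℕ → State K} {j : ℕ → Fin 4} {b : ℕ → Fin 4 → K}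
    (hc : ∀ k, IsIsolated p (c k).F ∧ Step0 p (c k) (c (k + 1))) (hw : FreeTail.IsWitnessedChain p c j b)
    (hr0 : ∀ e ∈ (c 0).F.support, (c 0).r ≤ e) (hfloor : ∀ k, ordZero (c k).F ≠ p) {k₀ d : ℕ} (hdp : d < p)
    (hshade : ∀ k, k₀ ≤ k → (c k).shade = (d : ℕ∞))
    (he3 : ∀ k, k₀ ≤ k → Module.finrank K (resVertex (c k)) = 3) :
    ∃ (ℓ : ℕ → Fin 4 → K) (a lam : ℕ → K), ∀ k, k₀ ≤ k →
      ℓ k ≠ 0 ∧ (∀ w, w ∈ resVertex (c k) ↔ dotProduct (ℓ k) w = 0) ∧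
      resForm (c k) = C (a k) * (∑ i, C (ℓ k i) * X i) ^ d ∧
      ℓ k (j k) + dotProduct (ℓ k) (b k) = 0 ∧
      lam k ≠ 0 ∧ (∀ i, i ≠ j k → ℓ (k + 1) i = lam k * ℓ k i) ∧
      ∃ i, i ≠ j k ∧ ℓ k i ≠ 0 := by
  -- choose the forms and coefficients stagewise (junk below `k₀`)
  have hex : ∀ k, ∃ (ℓ : Fin 4 → K) (a : K), k₀ ≤ k →
      ℓ ≠ 0 ∧ (∀ w, w ∈ resVertex (c k) ↔ dotProduct ℓ w = 0) ∧
        resForm (c k) = C a * (∑ i, C (ℓ i) * X i) ^ d := by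
    intro k
    by_cases hk : k₀ ≤ k
    · obtain ⟨ℓ, a, h⟩ := chain_resForm_eq_C_mul_pow p hc hfloor hdp hshade he3 hk
      exact ⟨ℓ, a, fun _ => h⟩
    · exact ⟨0, 0, fun h => absurd h hk⟩
  choose ℓ a hℓa using hex
  -- choose the units stagewise
  have hlam : ∀ k, ∃ lam : K, k₀ ≤ k → lam ≠ 0 ∧ ∀ i, i ≠ j k → ℓ (k + 1) i = lam * ℓ k i := by
    intro k
    by_cases hk : k₀ ≤ k
    · obtain ⟨hℓ, hV, -⟩ := hℓa k hk
      obtain ⟨-, hV', -⟩ := hℓa (k + 1) (by omega)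
      obtain ⟨⟨lam, hlam0, hlam⟩, -, -⟩ :=
        chain_linearForm_proportional p hc hw hr0 hfloor hshade hk hV hV' hℓ
      exact ⟨lam, fun _ => ⟨hlam0, hlam⟩⟩
    · exact ⟨0, fun h => absurd h hk⟩
  choose lam hlam' using hlam
  refine ⟨ℓ, a, lam, fun k hk => ?_⟩
  obtain ⟨hℓ, hV, hform⟩ := hℓa k hk
  obtain ⟨hlam0, hlamk⟩ := hlam' k hk
  obtain ⟨-, hj⟩ := chain_linearForm_direction p hc hw hr0 hfloor hshade hk hV
  obtain ⟨-, hV', -⟩ := hℓa (k + 1) (by omega)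
  obtain ⟨-, hoff, -⟩ := chain_linearForm_proportional p hc hw hr0 hfloor hshade hk hV hV' hℓ
  exact ⟨hℓ, hV, hform, hj, hlam0, hlamk, hoff⟩

end PowerChain

end ResCone

end Summit.ResolutionOfSingularities.ResolutionOfSingularities.Theorems.PIDim4

end
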